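import Literature.AlgebraicGeometry.Frobenioids.RlfPerfFactorial
import Literature.AlgebraicGeometry.Frobenioids.RealificationNatTrans
import Literature.AlgebraicGeometry.Frobenioids.PerfectionDivisorial
import Literature.AlgebraicGeometry.Frobenioids.PerfFactorialPrimes
import Literature.AlgebraicGeometry.Frobenioids.PerfFactorialSupport
import HarnessLib

/-!
# Frobenioids I, Def. 2.4 (i) / Prop. 5.3 — `f^rlf` is injective when the primes are pulled back
# disjointly AND the divisor monoid is finitely supported (sub-DAG W3, row P53/L02a′, repaired reading)

Mochizuki, *The geometry of Frobenioids I*, Kyushu J. Math. **62** (2008), Def. 2.4 (i) p. 48 (the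
realification `M^rlf`, "the divisor monoid `Φ^rlf`" of Prop. 5.3 p. 103 l. 12)
[cite: MochizukiFrdI2008, Def. 2.4(i) p.48] [cite: MochizukiFrdI2008, Prop. 5.3 p.103].

The typed slot `FrdI.Prop53Sub.RlfMapInjective'` (`Prop53Sub.lean`, seat abc-iut-w5-d137; shape of seat
abc-iut-L1-d2, cell ruling L1-lead R89 (r2)) asks: for perf-factorial `M`, `N` and a characteristically injective
`f : M → N` such that primary elements of DISTINCT primes of `M^pf` are sent by `f^pf` to elements of `N^rlf`
with DISJOINT supports, the realified map `f^rlf = IsPerfFactorial.Rlf.map` is injective.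

**Finding P53-F2 (seat abc-iut-w4-d084, cell STATUS 2026-08-26T02:58Z).**  As typed (arbitrary perf-factorial
`M`), that statement is not decidable from the kernel's axioms: a perf-factorial monoid may contain infinitely
supported elements (condition (d) of Def. 2.4 (i) makes every support block `{a | Supp a ⊆ Supp b}` of `M^pf`
a FULL product `∏_{𝔮 ∈ Supp b} M^pf_𝔮`), and a monotone additive map out of a full product `∏_A ℚ_{≥0}` need
not be determined by its values on the coordinate vectors when `A` carries a countably complete free
ultrafilter — from such an ultrafilter one builds a characteristically injective `f` with disjointly supported
images of primaries whose `f^rlf` is NOT injective, while without one `f^rlf` is computed prime by prime and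
the slot holds.  The divisor monoids of the paper (Weil / Cartier / arithmetic divisors, [FrdI] §6,
[FrdII] §1–§3) are FINITELY supported, and for those the slot is a theorem — this file:

* `IsPerfFactorial.Rlf.supp_map_restrict_subset` — `Supp(f^rlf(x|_𝔭)) ⊆ Supp(ι_N f^pf p)` for any primary
  `p ∈ 𝔭` (archimedean comparison at one prime, [EtTh] Lem. 3.5-style);
* `IsPerfFactorial.Rlf.eq_one_of_map_eq_one_of_supp_subset` — `f^rlf` kills no non-trivial element supported
  at a single prime (`f^pf` injective, `N^pf → N^rlf` injective);
* **`IsPerfFactorial.Rlf.map_injective_of_disjoint_supp_of_finite`** — the slot's conclusion under the slot's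
  hypotheses plus `∀ a : M^pf, Supp(a) finite`, by induction on the (finite) support: split off one prime
  `x = x|_𝔭 · x'`; the images of the two factors have disjoint supports, so `f^rlf x = f^rlf y` splits into
  `f^rlf(x|_𝔭) = f^rlf(y|_𝔭)` (⇒ `x|_𝔭 = y|_𝔭`: one prime is totally ordered) and `f^rlf x' = f^rlf y'`.

Proof-only (no definitions; the slot itself is untouched).  Seat abc-iut-w4-d084 (cell abc-iut, cone node
FrdI:Prop5.3, sub-DAG W3 row P53/L02a′; GAP-LEDGER row G-w4d084-1).  Nothing here bears on [IUTchIII]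
Cor. 3.12 (L1 = [FrdI], a refereed preparatory paper).
-/

noncomputable section

namespace Literature.AlgebraicGeometry.Frobenioids

open Function Literature.AnabelianGeometry.EtaleTheta

universe w

namespace IsPerfFactorial

namespace Rlf

variable {M : Type w} [CommMonoid M] (hM : IsPerfFactorial M)
variable {N : Type w} [CommMonoid N] (hN : IsPerfFactorial N)

/-! ### One prime at a time -/

/-- The underlying factorization of `ι(a) ∈ M^rlf` (`a ∈ M^pf`) is `factorMap a`.
[cite: MochizukiFrdI2008, Def. 2.4(i) p.48] -/
theorem coe_toRealification (a : Perfection M) : (hM.toRealification a : RlfFactor M) = factorMap M a := rfl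

/-- Splitting off one prime: every `x ∈ M^rlf` is `x|_𝔭 · x'` with `x'` trivial at `𝔭` and supported inside
`Supp(x)`. [cite: MochizukiFrdI2008, Def. 2.4(i) p.48] -/
theorem exists_eq_restrict_mul (x : hM.Rlf) (𝔭 : Primes (Perfection M)) :
    ∃ x' : hM.Rlf, x = hM.restrict 𝔭 x * x' ∧ (x' : RlfFactor M) 𝔭 = 1 ∧
      supp (x' : RlfFactor M) ⊆ supp (x : RlfFactor M) := by
  classical
  obtain ⟨b, hb⟩ := x.2
  let x'v : RlfFactor M := Function.update (x : RlfFactor M) 𝔭 1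
  have hsupp : supp x'v ⊆ supp (x : RlfFactor M) := by
    intro 𝔮 h𝔮
    by_cases h : 𝔮 = 𝔭
    · subst h
      exact (h𝔮 (Function.update_self _ _ _)).elim
    · have : x'v 𝔮 = (x : RlfFactor M) 𝔮 := Function.update_of_ne h _ _
      intro h1
      exact h𝔮 (this.trans h1)
  have hx'𝔭 : x'v 𝔭 = 1 := Function.update_self _ _ _
  refine ⟨⟨x'v, b, hsupp.trans hb⟩, ?_, hx'𝔭, hsupp⟩
  apply Subtype.ext
  funext 𝔮
  rw [coe_mul, Pi.mul_apply, coe_restrict]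
  by_cases h : 𝔮 = 𝔭
  · subst h
    rw [single'_apply_same]
    show _ = _ * x'v 𝔮
    rw [hx'𝔭, mul_one]
  · rw [single'_apply_of_ne h, one_mul]
    show _ = x'v 𝔮
    exact (Function.update_of_ne h _ _).symm

/-- Two elements of `M^rlf` supported at the same single prime are comparable (`M^rlf_𝔭 ≅ ℝ_{≥0}` is totally
ordered). [cite: MochizukiFrdI2008, Def. 2.4(i) p.48] -/
theorem dvd_total_of_supp_subset_singleton {a b : hM.Rlf} {𝔭 : Primes (Perfection M)}
    (ha : supp (a : RlfFactor M) ⊆ {𝔭}) (hb : supp (b : RlfFactor M) ⊆ {𝔭}) : a ∣ b ∨ b ∣ a := by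
  have htot := IsMonoprime.dvd_total (IsMonoprime.ofR (hM.isRMonoprime_rlfAt 𝔭))
    ((a : RlfFactor M) 𝔭) ((b : RlfFactor M) 𝔭)
  have key : ∀ {c d : hM.Rlf}, supp (c : RlfFactor M) ⊆ {𝔭} →
      (c : RlfFactor M) 𝔭 ∣ (d : RlfFactor M) 𝔭 → c ∣ d := by
    intro c d hc hcd
    refine (dvd_iff hM c d).mpr fun 𝔮 => ?_
    by_cases h : 𝔮 = 𝔭
    · subst h
      exact hcd
    · have : (c : RlfFactor M) 𝔮 = 1 := by
        by_contra hne
        exact h (hc hne)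
      rw [this]
      exact one_dvd _
  rcases htot with h | h
  · exact Or.inl (key ha h)
  · exact Or.inr (key hb h)

/-- `Supp(ι p) = {𝔭}` for a primary `p ∈ 𝔭` of `M^pf`: a primary element of another class dividing `p`
would be `≼`-equivalent to it. [cite: MochizukiFrdI2008, Def. 2.4(i) p.47] -/
theorem supp_toRealification_of_mem_carrier {𝔭 : Primes (Perfection M)} {p : Perfection M}
    (hp : p ∈ 𝔭.carrier) : supp (hM.toRealification p : RlfFactor M) = {𝔭} := by
  refine Set.Subset.antisymm ?_ (Set.singleton_subset_iff.mpr (hM.mem_supp_factorMap_of_mem_carrier hp))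
  intro 𝔮 h𝔮
  rw [coe_toRealification, hM.mem_supp_factorMap_iff] at h𝔮
  obtain ⟨x, hx, hxp⟩ := h𝔮
  have hx𝔭 : x ∈ 𝔭.carrier := 𝔭.mem_carrier_of_precsim hp hx.1.1 (Precsim.of_dvd hxp)
  obtain ⟨h₁, rfl⟩ := hx
  obtain ⟨h₂, rfl⟩ := hx𝔭
  rfl

/-- **`Supp(f^rlf(x|_𝔭)) ⊆ Supp(ι_N f^pf p)`** for every primary `p ∈ 𝔭`: `x|_𝔭 ≼ ι_M p` in `M^rlf`
(archimedean comparison inside `M^rlf_𝔭`), homomorphisms preserve `≼`, and `≼` controls supports.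
[cite: MochizukiFrdI2008, Prop. 5.3 p.103] -/
theorem supp_map_restrict_subset (f : M →* N) (x : hM.Rlf) {𝔭 : Primes (Perfection M)}
    {p : Perfection M} (hp : p ∈ 𝔭.carrier) :
    supp (map hM hN f (hM.restrict 𝔭 x) : RlfFactor N) ⊆
      supp (hN.toRealification (Perfection.map f p) : RlfFactor N) := by
  have h1 : hM.restrict 𝔭 x ≼ hM.toRealification p :=
    precsim_of_supp hM _ _ 𝔭 (hM.supp_restrict_subset 𝔭 x) (hM.mem_supp_factorMap_of_mem_carrier hp)
  have h2 : map hM hN f (hM.restrict 𝔭 x) ≼ map hM hN f (hM.toRealification p) := h1.map _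
  rw [map_toRealification] at h2
  exact supp_subset_of_precsim hN h2

/-- **`f^rlf` kills no non-trivial element supported at one prime** (for `f` injective): such an element
dominates `ι_M p` for a primary `p ∈ 𝔭`, so `ι_N f^pf p ≼ f^rlf d = 0` would force `f^pf p = 0`.
[cite: MochizukiFrdI2008, Prop. 5.3 p.103] -/
theorem eq_one_of_map_eq_one_of_supp_subset {f : M →* N} (hf : Injective f) {d : hM.Rlf}
    {𝔭 : Primes (Perfection M)} (hd : supp (d : RlfFactor M) ⊆ {𝔭}) (h1 : map hM hN f d = 1) : d = 1 := by
  by_contra hne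
  obtain ⟨𝔮, h𝔮⟩ := (ne_one_iff_supp_nonempty hM d).mp hne
  have h𝔮𝔭 : 𝔮 = 𝔭 := hd h𝔮
  subst h𝔮𝔭
  obtain ⟨⟨p, hp'⟩, hp⟩ := Quotient.exists_rep 𝔮
  have hpc : p ∈ 𝔮.carrier := ⟨hp', hp⟩
  -- `ι_M p ≼ d`
  have h2 : hM.toRealification p ≼ d :=
    precsim_of_supp hM _ _ 𝔮 (supp_toRealification_of_mem_carrier hM hpc).le h𝔮
  have h3 : hN.toRealification (Perfection.map f p) ≼ 1 := by
    have := h2.map (map hM hN f)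
    rwa [map_toRealification, h1] at this
  obtain ⟨n, -, hn⟩ := h3
  rw [one_pow] at hn
  have h4 : hN.toRealification (Perfection.map f p) = 1 := (isSharp hN).1 _ (isUnit_of_dvd_one hn)
  have h5 : Perfection.map f p = 1 := by
    apply hN.factorMap_injective
    have := congrArg Subtype.val h4
    rw [coe_toRealification, coe_one] at this
    rw [this, hN.factorMap_one]
  have h6 : p = 1 := Perfection.map_injective f hf (by rw [h5, map_one])
  exact hp'.1 h6

/-- `f^rlf(x|_𝔭) = f^rlf(y|_𝔭)` forces `x|_𝔭 = y|_𝔭` (one prime is totally ordered; `f^rlf` kills no single-prime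
element). [cite: MochizukiFrdI2008, Prop. 5.3 p.103] -/
theorem restrict_eq_of_map_restrict_eq {f : M →* N} (hf : Injective f) {x y : hM.Rlf}
    {𝔭 : Primes (Perfection M)} (h : map hM hN f (hM.restrict 𝔭 x) = map hM hN f (hM.restrict 𝔭 y)) :
    hM.restrict 𝔭 x = hM.restrict 𝔭 y := by
  haveI := isCancelMul hN
  have key : ∀ {a b : hM.Rlf}, supp (b : RlfFactor M) ⊆ {𝔭} → a ∣ b →
      map hM hN f a = map hM hN f b → a = b := by
    intro a b hb hab he
    obtain ⟨d, rfl⟩ := hab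
    have hd : supp (d : RlfFactor M) ⊆ {𝔭} := by
      refine Set.Subset.trans ?_ hb
      rw [coe_mul, mul_comm]
      exact supp_subset_supp_mul _ _
    rw [map_mul] at he
    have hd1 : map hM hN f d = 1 := mul_left_cancel (a := map hM hN f a) (by rw [mul_one]; exact he.symm)
    rw [eq_one_of_map_eq_one_of_supp_subset hM hN hf hd hd1, mul_one]
  rcases dvd_total_of_supp_subset_singleton hM (hM.supp_restrict_subset 𝔭 x)
      (hM.supp_restrict_subset 𝔭 y) with hxy | hyx
  · exact key (hM.supp_restrict_subset 𝔭 y) hxy h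
  · exact (key (hM.supp_restrict_subset 𝔭 x) hyx h.symm).symm

/-! ### Finitely supported elements: `f^rlf` is computed prime by prime -/

/-- **Supports of images of finitely supported elements**: if `Supp(x) ⊆ s` (finite), every prime in
`Supp(f^rlf x)` lies in `Supp(ι_N f^pf p)` for some primary `p` of a class `𝔭 ∈ s` — induction on `s`,
splitting off one prime at a time. [cite: MochizukiFrdI2008, Prop. 5.3 p.103] -/
theorem supp_map_subset_of_supp_subset_finset (f : M →* N) (s : Finset (Primes (Perfection M))) :
    ∀ x : hM.Rlf, supp (x : RlfFactor M) ⊆ ↑s →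
      ∀ 𝔯 ∈ supp (map hM hN f x : RlfFactor N), ∃ 𝔭 ∈ s, ∃ p ∈ 𝔭.carrier,
        𝔯 ∈ supp (hN.toRealification (Perfection.map f p) : RlfFactor N) := by
  classical
  induction s using Finset.induction with
  | empty =>
    intro x hx 𝔯 h𝔯
    have hx1 : x = 1 := by
      by_contra hne
      obtain ⟨𝔮, h𝔮⟩ := (ne_one_iff_supp_nonempty hM x).mp hne
      simpa using hx h𝔮
    rw [hx1, map_one] at h𝔯
    exact (h𝔯 rfl).elim
  | insert 𝔭 s h𝔭s ih =>
    intro x hx 𝔯 h𝔯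
    obtain ⟨x', hxx', hx'𝔭, hx's⟩ := exists_eq_restrict_mul hM x 𝔭
    have hx'sub : supp (x' : RlfFactor M) ⊆ ↑s := by
      intro 𝔮 h𝔮
      have h1 : 𝔮 ∈ insert 𝔭 s := by simpa using hx (hx's h𝔮)
      rcases Finset.mem_insert.mp h1 with h2 | h2
      · subst h2
        exact (h𝔮 hx'𝔭).elim
      · simpa using h2
    rw [hxx', map_mul, coe_mul] at h𝔯
    rcases supp_mul_subset _ _ h𝔯 with h1 | h1
    · obtain ⟨⟨p, hp'⟩, hp⟩ := Quotient.exists_rep 𝔭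
      have hpc : p ∈ 𝔭.carrier := ⟨hp', hp⟩
      exact ⟨𝔭, Finset.mem_insert_self _ _, p, hpc, supp_map_restrict_subset hM hN f x hpc h1⟩
    · obtain ⟨𝔮, h𝔮s, p, hp, h2⟩ := ih x' hx'sub 𝔯 h1
      exact ⟨𝔮, Finset.mem_insert_of_mem h𝔮s, p, hp, h2⟩

/-- **Injectivity of `f^rlf` on finitely supported elements** (slot `RlfMapInjective'` on `Supp ⊆ s`): the
disjointness hypothesis separates the image of `x|_𝔭` from the image of the rest, so an equality
`f^rlf x = f^rlf y` splits prime by prime. [cite: MochizukiFrdI2008, Prop. 5.3 p.103] -/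
theorem map_injective_on_supp_subset_finset {f : M →* N} (hf : Injective f)
    (hdisj : ∀ (𝔭 𝔮 : Primes (Perfection M)), 𝔭 ≠ 𝔮 → ∀ x ∈ 𝔭.carrier, ∀ y ∈ 𝔮.carrier,
      Disjoint (supp (hN.toRealification (Perfection.map f x) : RlfFactor N))
        (supp (hN.toRealification (Perfection.map f y) : RlfFactor N)))
    (s : Finset (Primes (Perfection M))) :
    ∀ x y : hM.Rlf, supp (x : RlfFactor M) ⊆ ↑s → supp (y : RlfFactor M) ⊆ ↑s →
      map hM hN f x = map hM hN f y → x = y := by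
  classical
  haveI := isCancelMul hN
  induction s using Finset.induction with
  | empty =>
    intro x y hx hy _
    have h1 : ∀ z : hM.Rlf, supp (z : RlfFactor M) ⊆ ↑(∅ : Finset (Primes (Perfection M))) → z = 1 := by
      intro z hz
      by_contra hne
      obtain ⟨𝔮, h𝔮⟩ := (ne_one_iff_supp_nonempty hM z).mp hne
      simpa using hz h𝔮
    rw [h1 x hx, h1 y hy]
  | insert 𝔭 s h𝔭s ih =>
    intro x y hx hy hxy
    obtain ⟨x', hxx', hx'𝔭, hx's⟩ := exists_eq_restrict_mul hM x 𝔭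
    obtain ⟨y', hyy', hy'𝔭, hy's⟩ := exists_eq_restrict_mul hM y 𝔭
    have hsub : ∀ {z z' : hM.Rlf}, supp (z : RlfFactor M) ⊆ ↑(insert 𝔭 s) → (z' : RlfFactor M) 𝔭 = 1 →
        supp (z' : RlfFactor M) ⊆ supp (z : RlfFactor M) → supp (z' : RlfFactor M) ⊆ ↑s := by
      intro z z' hz hz'𝔭 hz's 𝔮 h𝔮
      have h1 : 𝔮 ∈ insert 𝔭 s := by simpa using hz (hz's h𝔮)
      rcases Finset.mem_insert.mp h1 with h2 | h2
      · subst h2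
        exact (h𝔮 hz'𝔭).elim
      · simpa using h2
    have hx'sub := hsub hx hx'𝔭 hx's
    have hy'sub := hsub hy hy'𝔭 hy's
    obtain ⟨⟨p, hp'⟩, hp⟩ := Quotient.exists_rep 𝔭
    have hpc : p ∈ 𝔭.carrier := ⟨hp', hp⟩
    -- the image of a remainder avoids `Supp(ι_N f^pf p)`
    have havoid : ∀ {z' : hM.Rlf}, supp (z' : RlfFactor M) ⊆ ↑s →
        ∀ 𝔯 ∈ supp (hN.toRealification (Perfection.map f p) : RlfFactor N),
          (map hM hN f z' : RlfFactor N) 𝔯 = 1 := by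
      intro z' hz' 𝔯 h𝔯
      by_contra hne
      obtain ⟨𝔮, h𝔮s, q, hq, h𝔯q⟩ := supp_map_subset_of_supp_subset_finset hM hN f s z' hz' 𝔯 hne
      have hne' : 𝔭 ≠ 𝔮 := by
        rintro rfl
        exact h𝔭s h𝔮s
      exact Set.disjoint_left.mp (hdisj 𝔭 𝔮 hne' p hpc q hq) h𝔯 h𝔯q
    -- the images of the `𝔭`-parts agree
    have hres : map hM hN f (hM.restrict 𝔭 x) = map hM hN f (hM.restrict 𝔭 y) := by
      apply Subtype.ext
      funext 𝔯
      have ex : ((map hM hN f x : hN.Rlf) : RlfFactor N) 𝔯 = ((map hM hN f y : hN.Rlf) : RlfFactor N) 𝔯 := by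
        rw [hxy]
      rw [hxx', hyy', map_mul, map_mul, coe_mul, coe_mul, Pi.mul_apply, Pi.mul_apply] at ex
      by_cases h𝔯 : 𝔯 ∈ supp (hN.toRealification (Perfection.map f p) : RlfFactor N)
      · rwa [havoid hx'sub 𝔯 h𝔯, havoid hy'sub 𝔯 h𝔯, mul_one, mul_one] at ex
      · have h1 : ∀ z : hM.Rlf, (map hM hN f (hM.restrict 𝔭 z) : RlfFactor N) 𝔯 = 1 := by
          intro z
          by_contra hne
          exact h𝔯 (supp_map_restrict_subset hM hN f z hpc hne)
        rw [h1 x, h1 y]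
    have hres' : hM.restrict 𝔭 x = hM.restrict 𝔭 y := restrict_eq_of_map_restrict_eq hM hN hf hres
    -- hence the images of the remainders agree, and the induction hypothesis applies
    have hrem : map hM hN f x' = map hM hN f y' := by
      have ex := hxy
      rw [hxx', hyy', map_mul, map_mul, hres'] at ex
      exact mul_left_cancel ex
    rw [hxx', hyy', hres', ih x' y' hx'sub hy'sub hrem]

/-- **Slot `FrdI.Prop53Sub.RlfMapInjective'` for FINITELY SUPPORTED divisor monoids** (the repaired reading of
sub-DAG W3 row P53/L02a′, finding P53-F2): for perf-factorial `M`, `N` with every `a ∈ M^pf` finitely supported,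
a characteristically injective `f : M → N` under which primary elements of distinct primes have images with
disjoint supports in `N^rlf` induces an INJECTIVE `f^rlf : M^rlf → N^rlf`.  (Only `Injective f` is used from
`IsCharInjective f`.) [cite: MochizukiFrdI2008, Prop. 5.3 p.103] -/
theorem map_injective_of_disjoint_supp_of_finite {f : M →* N} (hf : IsCharInjective f)
    (hdisj : ∀ (𝔭 𝔮 : Primes (Perfection M)), 𝔭 ≠ 𝔮 → ∀ x ∈ 𝔭.carrier, ∀ y ∈ 𝔮.carrier,
      Disjoint (supp (hN.toRealification (Perfection.map f x) : RlfFactor N))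
        (supp (hN.toRealification (Perfection.map f y) : RlfFactor N)))
    (hfin : ∀ a : Perfection M, (supp (factorMap M a)).Finite) :
    Injective (map hM hN f) := by
  classical
  intro x y hxy
  obtain ⟨bx, hbx⟩ := x.2
  obtain ⟨by_, hby⟩ := y.2
  have hfx : (supp (x : RlfFactor M)).Finite := (hfin bx).subset hbx
  have hfy : (supp (y : RlfFactor M)).Finite := (hfin by_).subset hby
  let s : Finset (Primes (Perfection M)) := hfx.toFinset ∪ hfy.toFinset
  refine map_injective_on_supp_subset_finset hM hN hf.1 hdisj s x y ?_ ?_ hxy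
  · intro 𝔮 h𝔮
    exact Finset.mem_coe.mpr (Finset.mem_union_left _ (hfx.mem_toFinset.mpr h𝔮))
  · intro 𝔮 h𝔮
    exact Finset.mem_coe.mpr (Finset.mem_union_right _ (hfy.mem_toFinset.mpr h𝔮))

/-- The same with the finiteness hypothesis on `M` rather than `M^pf` (`Supp(a^{1/n}) = Supp(a)`).
[cite: MochizukiFrdI2008, Prop. 5.3 p.103] -/
theorem map_injective_of_disjoint_supp_of_finite' {f : M →* N} (hf : IsCharInjective f)
    (hdisj : ∀ (𝔭 𝔮 : Primes (Perfection M)), 𝔭 ≠ 𝔮 → ∀ x ∈ 𝔭.carrier, ∀ y ∈ 𝔮.carrier,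
      Disjoint (supp (hN.toRealification (Perfection.map f x) : RlfFactor N))
        (supp (hN.toRealification (Perfection.map f y) : RlfFactor N)))
    (hfin : ∀ a : M, (supp (factorMap M (Perfection.of M a))).Finite) :
    Injective (map hM hN f) := by
  refine map_injective_of_disjoint_supp_of_finite hM hN hf hdisj fun a => ?_
  obtain ⟨⟨a₀, n⟩, rfl⟩ := Perfection.mk_surjective a
  dsimp only
  have h1 : factorMap M (Perfection.mk a₀ n) ^ (n : ℕ) = factorMap M (Perfection.of M a₀) := by
    rw [← hM.factorHom_apply, ← map_pow, Perfection.mk_pow_self, hM.factorHom_apply]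
  have h2 : supp (factorMap M (Perfection.mk a₀ n)) = supp (factorMap M (Perfection.of M a₀)) := by
    rw [← h1, supp_pow _ n.pos]
  rw [h2]
  exact hfin a₀

end Rlf

end IsPerfFactorial

end Literature.AlgebraicGeometry.Frobenioids
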